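import Mathlib
import Summits.KontsevichZagierPeriods.Zeta5Search.PeriodicCellKitRuns
import HarnessLib

/-!
# ζ(5) search — PERIODIC CELL KIT III: ray-C1 periodic cells as kernel-checked TABLE ROWS (fam-denom g14)

HONEST FRAMING: systematic search; no irrationality claim unless certified.  Integer bookkeeping of net exponents of
the T1 ray C1 (`bRay β1 n`, `d = 64n`) below `θ = 1`; nothing here is an irrationality statement.

A periodic cell file `RayC1PeriodicC…` proves, for one Farey cell `u < y < v` (`y = (n − m p)/p`) and one parity class
`(n mod 2, m mod 2)`, a level-class COVER valid for every `m = b₁ + 2t` by 18 slot typings whose ≈ 600 side conditions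
are closed by `omega`.  Here the same content is DATA: a `Cell` row (window context, 17 slot cuts, per slot the 15 base
run lengths + well split + centre flag + ≤ 4 Farkas bases as hypothesis-index quadruples), a Boolean checker `cellOK`,
and ONE soundness theorem `cover_of_cellOK : cellOK c = true → (window hypotheses) → Cover (bRay β1 n) p (c.rc.map (pdec t))`.
Every former `omega` obligation is an integer-affine implication in `(x, n, p, P = t·p)`, discharged by
`CellKit.implOKq` (parity substitution, gcd refinement, Farkas multipliers computed from the named basis and VERIFIED in
the kernel — `PeriodicCellKitLin`); the typing is `levels_of_truns` (`PeriodicCellKitRuns`) and `ray1TypeP_ne/eq`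
(`RayC1Periodic`).  A class file then reads `theorem cover … := cover_of_cellOK cell (by decide +kernel) …` + the 8-line `bound`.
-/

open Finset

namespace Summit.KontsevichZagierPeriods.Zeta5Search.CellKit

open Summit.KontsevichZagierPeriods.Zeta5Search.ClusterValuation (netExp)
open Summit.KontsevichZagierPeriods.Zeta5Search.ClassTypeCover
open Summit.KontsevichZagierPeriods.Zeta5Search.T1Rays (bRay β1)

variable {n p x t P : ℕ}

/-! ## §4 Slots: the checker and its soundness -/

/-- A SLOT ROW: the 15 base run lengths (low, d1 … d6, well, u6 … u1, high), the well split `wl + [centre] + wr`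
(even `n` only), the bump and centre flags, and the Farkas bases as index quadruples into the refined hypothesis list. -/
structure Slot where
  /-- base run lengths per level region -/
  l : List ℕ
  /-- well piece left of the centre (even `n`) -/
  wl : ℕ
  /-- well piece right of the centre (even `n`) -/
  wr : ℕ
  /-- class straddles the centre position (even `n`): a one-class bump of depth −5 -/
  bump : Bool
  /-- self-conjugate class? -/
  cen : Bool
  /-- Farkas bases -/
  quads : List (ℕ × ℕ × ℕ × ℕ)
deriving Repr

/-- Slopes (in `t`) of the 15 runs: the region widths of ray C1 per unit of `m`, halved positions. -/
def slopeT : List ℕ := [40, 4, 6, 4, 6, 4, 6, 30, 6, 4, 6, 4, 6, 4, 40]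

/-- The TYPING RUNS of a slot: regions `0 … 6`, the well (one piece `wo` for odd `n`; `wl ⊔ wr` merged, or
`wl, centre, wr` with the bump, for even `n`), regions `11 … 17`. -/
def mkTruns (a : ℕ) (s : Slot) : List TRun :=
  ((List.range 7).map fun i => (⟨i, s.l.getD i 0, slopeT.getD i 0, false, 0, 0, 0⟩ : TRun)) ++
  (if a = 1 then [⟨10, s.l.getD 7 0, 30, false, 0, 0, 0⟩]
   else if s.bump then [⟨7, s.wl, 15, false, 0, 0, 0⟩, ⟨8, 1, 0, false, 0, 0, 0⟩, ⟨9, s.wr, 15, false, 0, 0, 0⟩]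
   else [⟨7, s.wl, 15, true, 9, s.wr, 15⟩]) ++
  ((List.range 7).map fun j => (⟨11 + j, s.l.getD (8 + j) 0, slopeT.getD (8 + j) 0, false, 0, 0, 0⟩ : TRun))

/-- Position obligations `x + L0 p + S0 P ≤ 85 n < x + L0 p + S0 P + p`. -/
def posObls (L0 S0 : ℕ) : List LinForm := [⟨-1, 85, -(L0 : ℤ), -(S0 : ℤ), 0⟩, ⟨1, -85, L0 + 1, S0, -1⟩]

/-- How the centre fact of a slot is certified: syntactically from the two centre cuts + parity (self-conjugate slot);
by parity or by a certified strict side otherwise. -/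
def cenOK (C : Ctx) (lc hi : Option Cut) (s : Slot) (L0 S0 : ℕ) (H : List LinForm) : Bool :=
  if s.cen then
    match lc, hi with
    | some cl, some ch => decide (cl.kind = .Clo) && decide (ch.kind = .Chi) && decide (cl.j0 = L0) && decide (cl.σ = S0) &&
        decide (ch.j0 = L0) && decide (ch.σ = S0) && decide (L0 % 2 = C.a % 2) && decide (S0 % 2 = 0)
    | _, _ => false
  else
    (decide (L0 % 2 ≠ C.a % 2) && decide (S0 % 2 = 0)) ||
    implOKq C.a H s.quads [⟨-2, 85, -(L0 : ℤ), -(S0 : ℤ), -1⟩] || implOKq C.a H s.quads [⟨2, -85, L0, S0, -1⟩]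

/-- **The slot checker.** -/
def slotOK (C : Ctx) (lc hi : Option Cut) (s : Slot) : Bool :=
  let R := tword (mkTruns C.a s)
  let L0 := rlen0 R - 1
  let S0 := rlslope R
  let H := rawHyps C lc hi s.cen L0 S0
  decide (1 ≤ rlen0 R) && decide (C.a < 2) && trunsOK C.a (mkTruns C.a s) && cenOK C lc hi s L0 S0 H &&
    implOKq C.a H s.quads (posObls L0 S0 ++ trunObls (mkTruns C.a s) 0 0)

/-- A non-self-conjugate class by parity. -/
theorem parity_ne {L0 S0 a : ℕ} (hp2 : p % 2 = 1) (hpar : n % 2 = a) (hL0 : L0 % 2 ≠ a % 2) (hS0 : S0 % 2 = 0) :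
    2 * x + L0 * p + S0 * P ≠ 85 * n := by
  have m1 : L0 * p % 2 = L0 % 2 := by rw [Nat.mul_mod, hp2]; omega
  have m2 : S0 * P % 2 = 0 := by rw [Nat.mul_mod, hS0]; simp
  omega

/-- A self-conjugate class from its two centre cuts and parity. -/
theorem parity_eq {L0 S0 a : ℕ} (hp2 : p % 2 = 1) (hpar : n % 2 = a) (hL0 : L0 % 2 = a % 2) (hS0 : S0 % 2 = 0)
    (h1 : ¬ 2 * x + L0 * p + S0 * P < 85 * n) (h2 : 2 * x + L0 * p + S0 * P < 85 * n + 2) :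
    2 * x + L0 * p + S0 * P = 85 * n := by
  have m1 : L0 * p % 2 = L0 % 2 := by rw [Nat.mul_mod, hp2]; omega
  have m2 : S0 * P % 2 = 0 := by rw [Nat.mul_mod, hS0]; simp
  omega

/-- **Soundness of the slot checker**: the class of `x` has the slot's type, for every `t`. -/
theorem slot_sound (C : Ctx) (lc hi : Option Cut) (s : Slot) (h : slotOK C lc hi s = true) [Fact p.Prime]
    (hP : t * p = P) (hpar : n % 2 = C.a) (hp : C.pmin ≤ p) (hp2 : p % 2 = 1)
    (hA : (C.u2 * C.b1 + C.u1) * p + 2 * C.u2 * P < C.u2 * n) (hB : C.v2 * n < (C.v2 * C.b1 + C.v1) * p + 2 * C.v2 * P)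
    (hx : x < p) (hlc : ∀ c, lc = some c → c.test x n p P = false) (hhi : ∀ c, hi = some c → c.test x n p P = true) :
    IsType (bRay β1 n) p x (rdecode (tword (mkTruns C.a s)) t) s.cen := by
  unfold slotOK at h
  simp only [Bool.and_eq_true, decide_eq_true_eq] at h
  obtain ⟨⟨⟨⟨hlen, ha2⟩, hok⟩, hcen⟩, himpl⟩ := h
  generalize hT : mkTruns C.a s = T at *
  generalize hR : tword T = R at *
  generalize hL0 : rlen0 R - 1 = L0 at *
  generalize hS0 : rlslope R = S0 at *
  have hlen' : rlen0 R = L0 + 1 ∧ rlslope R = S0 := ⟨by omega, hS0⟩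
  have hn' : (n : ℤ) = 2 * (n / 2 : ℕ) + (C.a : ℤ) := by omega
  have hp' : (p : ℤ) = 2 * (p / 2 : ℕ) + 1 := by omega
  -- the centre fact
  have hcenfact : (s.cen = true → 2 * x + L0 * p + S0 * P = 85 * n) ∧
      (s.cen = false → 2 * x + L0 * p + S0 * P ≠ 85 * n) := by
    unfold cenOK at hcen
    cases hs : s.cen
    · simp only [hs, Bool.false_eq_true, if_false, Bool.or_eq_true, Bool.and_eq_true, decide_eq_true_eq] at hcen
      refine ⟨fun h => absurd h (by simp), fun _ => ?_⟩
      have H0 := rawHyps_hold C lc hi false L0 S0 hx hp hA hB hlc hhi (by simp)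
      rcases hcen with (⟨hL, hS⟩ | hc) | hc
      · exact parity_ne hp2 hpar hL hS
      · have e := implOKq_sound hc hn' hp' H0 _ (List.mem_singleton_self _)
        simp only [LinForm.eval, neg_mul] at e; zify; omega
      · have e := implOKq_sound hc hn' hp' H0 _ (List.mem_singleton_self _)
        simp only [LinForm.eval, neg_mul] at e; zify; omega
    · simp only [hs, if_true] at hcen
      refine ⟨fun _ => ?_, fun h => absurd h (by simp)⟩
      cases lc with
      | none => simp at hcen
      | some cl =>
        cases hi with
        | none => simp at hcen
        | some ch =>
          simp only [Bool.and_eq_true, decide_eq_true_eq] at hcen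
          obtain ⟨⟨⟨⟨⟨⟨⟨k1, k2⟩, j1⟩, s1⟩, j2⟩, s2⟩, pl⟩, ps⟩ := hcen
          have t1 := hlc cl rfl
          have t2 := hhi ch rfl
          obtain ⟨clk, clc, clj, cls⟩ := cl
          obtain ⟨chk, chc, chj, chs⟩ := ch
          simp only at k1 k2 j1 s1 j2 s2
          subst k1 k2 j1 s1 j2 s2
          simp only [Cut.test, decide_eq_false_iff_not, decide_eq_true_eq] at t1 t2
          exact parity_eq hp2 hpar pl ps t1 t2
  have H := rawHyps_hold C lc hi s.cen L0 S0 hx hp hA hB hlc hhi hcenfact.1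
  have hobs := implOKq_sound himpl hn' hp' H
  have eL := hobs _ (List.mem_append_left _ (List.mem_cons_self ..))
  have eL' := hobs _ (List.mem_append_left _ (List.mem_cons_of_mem _ (List.mem_cons_self ..)))
  simp only [LinForm.eval] at eL eL'
  have hL : x + L0 * p + S0 * P ≤ 85 * n := by zify; linarith
  have hL2 : 85 * n < x + L0 * p + S0 * P + p := by zify; linarith
  have hlev : Levels (bRay β1 n) x p (rdecode R t) := by
    rw [← hR]
    exact levels_run_start (levels_of_truns hP hpar T 0 0 hok (fun f hf => hobs f (List.mem_append_right _ hf)))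
  cases hs : s.cen
  · exact ray1TypeP_ne hP R L0 S0 hlen' hx hL hL2 hlev (hcenfact.2 hs)
  · exact ray1TypeP_eq hP R L0 S0 hlen' hx hL hL2 hlev (hcenfact.1 hs)

/-! ## §5 Cells: the chain of cuts and the cover -/

/-- A CELL ROW: window context, the 17 slot cuts in walking order, the 18 slots. -/
structure Cell where
  /-- window context -/
  ctx : Ctx
  /-- slot cuts -/
  cuts : List Cut
  /-- slots -/
  slots : List Slot
deriving Repr

/-- The periodic cover word list of a cell (what the guard checks `pcheck*` read). -/
def Cell.rc (c : Cell) : List PRun := c.slots.map fun s => (tword (mkTruns c.ctx.a s), s.cen)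

/-- The chain checker: slot `k` is checked between cut `k-1` (failed) and cut `k` (passed). -/
def chainOK (C : Ctx) : Option Cut → List Cut → List Slot → Bool
  | _, _, [] => false
  | lc, [], s :: ss => ss.isEmpty && slotOK C lc none s
  | lc, c :: cs, s :: ss => slotOK C lc (some c) s && chainOK C (some c) cs ss

/-- **The cell checker.** -/
def cellOK (c : Cell) : Bool := chainOK c.ctx none c.cuts c.slots

/-- Soundness of the chain walk. -/
theorem chain_sound (C : Ctx) [Fact p.Prime] (hP : t * p = P) (hpar : n % 2 = C.a) (hp : C.pmin ≤ p) (hp2 : p % 2 = 1)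
    (hA : (C.u2 * C.b1 + C.u1) * p + 2 * C.u2 * P < C.u2 * n) (hB : C.v2 * n < (C.v2 * C.b1 + C.v1) * p + 2 * C.v2 * P) :
    ∀ (cs : List Cut) (lc : Option Cut) (ss : List Slot), chainOK C lc cs ss = true →
      ∀ x, x < p → (∀ c, lc = some c → c.test x n p P = false) →
        ∃ tc ∈ (ss.map fun s => (tword (mkTruns C.a s), s.cen)).map (pdec t), IsType (bRay β1 n) p x tc.1 tc.2
  | [], lc, ss, h, x, hx, hlc => by
    cases ss with
    | nil => simp [chainOK] at h
    | cons s ss =>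
      simp only [chainOK, Bool.and_eq_true] at h
      exact ⟨_, List.mem_map.mpr ⟨_, List.mem_map.mpr ⟨s, List.mem_cons_self .., rfl⟩, rfl⟩,
        slot_sound C lc none s h.2 hP hpar hp hp2 hA hB hx hlc (by simp)⟩
  | c :: cs, lc, ss, h, x, hx, hlc => by
    cases ss with
    | nil => simp [chainOK] at h
    | cons s ss =>
      simp only [chainOK, Bool.and_eq_true] at h
      cases hc : c.test x n p P
      · obtain ⟨tc, hm, ht⟩ := chain_sound C hP hpar hp hp2 hA hB cs (some c) ss h.2 x hx
          (fun c' hc' => by cases hc'; exact hc)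
        exact ⟨tc, List.mem_cons_of_mem _ hm, ht⟩
      · exact ⟨_, List.mem_map.mpr ⟨_, List.mem_map.mpr ⟨s, List.mem_cons_self .., rfl⟩, rfl⟩,
          slot_sound C lc (some c) s h.1 hP hpar hp hp2 hA hB hx hlc (fun c' hc' => by cases hc'; exact hc)⟩

/-- **THE KIT THEOREM.**  A cell row that passes `cellOK` yields the periodic level-class cover of its class, for every
`t` (i.e. every `m = b1 + 2t`), under the window hypotheses. -/
theorem cover_of_cellOK (c : Cell) (h : cellOK c = true) [Fact p.Prime] (hP : t * p = P) (hpar : n % 2 = c.ctx.a)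
    (hp : c.ctx.pmin ≤ p) (hp2 : p % 2 = 1)
    (hA : (c.ctx.u2 * c.ctx.b1 + c.ctx.u1) * p + 2 * c.ctx.u2 * P < c.ctx.u2 * n)
    (hB : c.ctx.v2 * n < (c.ctx.v2 * c.ctx.b1 + c.ctx.v1) * p + 2 * c.ctx.v2 * P) :
    Cover (bRay β1 n) p (c.rc.map (pdec t)) := fun x hx =>
  chain_sound c.ctx hP hpar hp hp2 hA hB c.cuts none c.slots h x hx (by simp)

end Summit.KontsevichZagierPeriods.Zeta5Search.CellKit
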